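import Literature.Geometry.Riemannian.ShrinkerPotentialGrowthProofs
import Literature.Geometry.Riemannian.ParallelTransportCorners
import Literature.Geometry.Riemannian.GeodesicBallsExp
import Literature.Geometry.Riemannian.EnergySecondVariationIntegral
import Literature.Geometry.Riemannian.RicciFlowScalarMaximumPrinciple
import Literature.Analysis.FunctionSpaces.SmoothParametricIntegral
import HarnessLib

/-!
# An upper barrier for `d(p, ·)²` at the endpoint of a geodesic, with the sharp Laplacian bound
# of Bamler 2020a, Thm. 3.5 (the spatial half of `(∂ₜ − Δ_x − Δ_y) d_t² ≥ −H_n`)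

R. Bamler, *Entropy and heat kernel bounds on a Ricci flow background*, arXiv:2008.07093 (2020a),
§3.2, proof of Theorem 3.5: along an arclength geodesic `γ : [0, d] → M` from `x` to `y` with a
parallel orthonormal frame `e₁ = γ', e₂, …, e_n`, the variations `γᵢ_u(s)` with
`∂_u γᵢ_u(s) = sin(πs/2d) eᵢ(s)` and `(D/∂u)∂_u γᵢ_u = 0` have energies `Eᵢ(u)` with
`d_t²(x, γᵢ_u(d)) ≤ 2d Eᵢ(u)`, equality at `u = 0`, whence
`Δ_y d_t²(x, y) ≤ 2 + ∫₀ᵈ (2(n−1)d (π/2d)² cos²(πs/2d) − 2d sin²(πs/2d) Ric(γ', γ')) ds`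
"(since `v_i(d) = e_i(d)` and `(D/∂u)∂_u γ_u^i = 0`, we can sum over `i = 2, …, n`)".

Bamler states the inequality for `d²` itself at pairs not in each other's cut locus and reduces
the general case to it by Calabi's trick. For the BARRIER form consumed by the tree
(`bamler_distSq_heatOperator_barrier`, `BamlerDistanceDistortion.lean`; users
`VarianceMonotoneOfBarrier.lean`, `HConcentrationOfBarrier.lean`) no cut-locus analysis is
needed: the energy `2d E` of the printed variations, read through normal coordinates at `y`,
IS an upper barrier for `d(x, ·)²` at `y`, smooth near `y`, and its Hessian in the direction `eᵢ(d)`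
is bounded by `2d Eᵢ''(0)` — this file proves exactly that (`exists_distSq_barrier_at_endpoint`),
for a smooth complete Riemannian metric on a manifold with an arbitrary boundaryless model with
corners (smooth parallel orthonormal frames in that generality: `ParallelTransportCorners.lean`).

Main results (everything proved; no definitions of `Prop` type, no named facts):

* `deriv2_le_of_le_quadratic` — the one-variable squeeze: if `k ≤ k(0) + aσ + (B + ε)σ²` near `0`
  for every `ε > 0` and `k` is twice differentiable at `0`, then `k''(0) ≤ 2B`;
* `trace_eq_sum_of_orthonormal_frame` — `tr_g T = ∑ₒ T(fₒ, fₒ)` in a `g`-orthonormal frame given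
  as a family with `card = dim`;
* `exists_distSq_barrier_at_endpoint` — **the endpoint barrier**: for `γ(t) = exp_p(tu)`,
  `|u|_g = 1`, `d > 0`, `y = γ(d)`, there is `β : M → ℝ`, `C^∞` near `y`, with `d(p, ·)² ≤ β` near
  `y`, `β(y) = d²`, and
  `Δ_g β(y) ≤ 2 + 2d ∫₀ᵈ ((dim M − 1)(π/2d)² cos²(πt/2d) − sin²(πt/2d) Ric(γ̇(t), γ̇(t))) dt`,
  together with the continuity of `t ↦ Ric(γ̇(t), γ̇(t))`.

## References

* R. H. Bamler, *Entropy and heat kernel bounds on a Ricci flow background*, arXiv:2008.07093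
  (2020), §3.1 Thm. 3.5 and §3.2 (proof). [Bamler2020Entropy]
* J. M. Lee, *Introduction to Riemannian Manifolds*, 2nd ed. (2018), Thm. 6.3, Cor. 6.12–6.13,
  Thm. 10.22 (second variation). [LeeRiemannianManifolds2018]
-/

noncomputable section

open Bundle Set Function Filter MeasureTheory intervalIntegral
open scoped Manifold ContDiff Topology

namespace Literature.Geometry.Riemannian

open Lorentzian Lorentzian.PseudoRiemannianMetric

/-! ### §1 One-variable calculus: the squeeze lemma and a cutoff -/

section Calculus

/-- **Squeeze for the second derivative.** If `k` is differentiable near `0`, `k'` is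
differentiable at `0` with derivative `k₂`, and for every `ε > 0` the quadratic upper bound
`k σ ≤ k 0 + a σ + (B + ε) σ²` holds for `σ` near `0`, then `k₂ ≤ 2 B` (otherwise
`q(σ) = k 0 + aσ + (B + ε)σ² − k σ ≥ 0` has a local minimum at `0`, so `q'(0) = 0`, while
`q''(0) = 2(B + ε) − k₂ < 0` for small `ε` forces a strict local maximum). Elementary calculus
(second-derivative test). [folklore] -/
theorem deriv2_le_of_le_quadratic {k k' : ℝ → ℝ} {k₂ a B : ℝ}
    (hk : ∀ᶠ σ in 𝓝 (0 : ℝ), HasDerivAt k (k' σ) σ) (hk' : HasDerivAt k' k₂ 0)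
    (hB : ∀ ε > (0 : ℝ), ∀ᶠ σ in 𝓝 (0 : ℝ), k σ ≤ k 0 + a * σ + (B + ε) * σ ^ 2) :
    k₂ ≤ 2 * B := by
  by_contra hlt
  push Not at hlt
  set ε : ℝ := (k₂ - 2 * B) / 4 with hε_def
  have hε : 0 < ε := by rw [hε_def]; linarith
  -- `q = k − (k 0 + aσ + (B + ε)σ²) ≤ 0` near `0`, `q 0 = 0`
  set q : ℝ → ℝ := fun σ ↦ k σ - (k 0 + a * σ + (B + ε) * σ ^ 2) with hq_def
  set q' : ℝ → ℝ := fun σ ↦ k' σ - (a + (B + ε) * (2 * σ)) with hq'_def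
  have hq : ∀ᶠ σ in 𝓝 (0 : ℝ), HasDerivAt q (q' σ) σ := by
    filter_upwards [hk] with σ hσ
    have h1 : HasDerivAt (fun σ : ℝ ↦ a * σ) a σ := by
      simpa using (hasDerivAt_id σ).const_mul a
    have h3 : HasDerivAt (fun σ : ℝ ↦ (B + ε) * σ ^ 2) ((B + ε) * (2 * σ)) σ := by
      simpa using (hasDerivAt_pow 2 σ).const_mul (B + ε)
    have h2 : HasDerivAt (fun σ ↦ k 0 + a * σ + (B + ε) * σ ^ 2) (a + (B + ε) * (2 * σ)) σ := by
      simpa using (h1.const_add (k 0)).fun_add h3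
    exact hσ.fun_sub h2
  have hq'd : HasDerivAt q' (k₂ - (B + ε) * 2) 0 := by
    have h1 : HasDerivAt (fun σ : ℝ ↦ (B + ε) * (2 * σ)) ((B + ε) * 2) 0 := by
      simpa using ((hasDerivAt_id (0 : ℝ)).const_mul 2).const_mul (B + ε)
    have h2 : HasDerivAt (fun σ ↦ a + (B + ε) * (2 * σ)) ((B + ε) * 2) 0 := by
      simpa using h1.const_add a
    exact hk'.fun_sub h2
  have hq0 : q 0 = 0 := by simp [hq_def]
  have hmax : IsLocalMax q 0 := by
    filter_upwards [hB ε hε] with σ hσ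
    rw [hq0]
    show k σ - (k 0 + a * σ + (B + ε) * σ ^ 2) ≤ 0
    linarith
  have hq'0 : q' 0 = 0 := hmax.hasDerivAt_eq_zero (hq.self_of_nhds)
  have hpos : 0 < k₂ - (B + ε) * 2 := by rw [hε_def]; linarith
  have hlt' := eventually_lt_of_hasDerivAt_deriv_pos hq hq'd hq'0 hpos
  -- but `q ≤ 0 = q 0` near `0`: contradiction at any point of the punctured neighbourhood
  have hle : ∀ᶠ σ in 𝓝[≠] (0 : ℝ), q σ ≤ q 0 := nhdsWithin_le_nhds hmax
  obtain ⟨σ, hσ₁, hσ₂⟩ := (hlt'.and hle).exists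
  exact absurd hσ₂ (not_le.2 hσ₁)

/-- **A smooth cutoff equal to `1` near `[0, d]` and to `0` off `(−1/2, d + 1/2)`**:
`χ(t) = ρ(4t + 2) ρ(4(d − t) + 2)` with `ρ = Real.smoothTransition`. [folklore] -/
theorem exists_smooth_cutoff_Icc (d : ℝ) :
    ∃ χ : ℝ → ℝ, ContDiff ℝ ∞ χ ∧ (∀ t ∈ Ioo (-1 / 4 : ℝ) (d + 1 / 4), χ t = 1) ∧
      (∀ t, t ≤ -1 / 2 → χ t = 0) ∧ (∀ t, d + 1 / 2 ≤ t → χ t = 0) := by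
  refine ⟨fun t ↦ Real.smoothTransition (4 * t + 2) * Real.smoothTransition (4 * (d - t) + 2),
    ?_, ?_, ?_, ?_⟩
  · exact (Real.smoothTransition.contDiff.comp (by fun_prop)).mul
      (Real.smoothTransition.contDiff.comp (by fun_prop))
  · intro t ht
    simp only
    rw [Real.smoothTransition.one_of_one_le (by linarith [ht.1]),
      Real.smoothTransition.one_of_one_le (by linarith [ht.2]), one_mul]
  · intro t ht
    simp only
    rw [Real.smoothTransition.zero_of_nonpos (by linarith), zero_mul]
  · intro t ht
    simp only
    rw [Real.smoothTransition.zero_of_nonpos (x := 4 * (d - t) + 2) (by linarith), mul_zero]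

end Calculus

/-! ### §2 The metric trace in an orthonormal frame given as a family -/

section Trace

variable {E : Type*} [NormedAddCommGroup E] [NormedSpace ℝ E] {H : Type*} [TopologicalSpace H]
  {I : ModelWithCorners ℝ E H} {M : Type*} [TopologicalSpace M] [ChartedSpace H M]
  [IsManifold I ∞ M] {n : ℕ∞ω} [FiniteDimensional ℝ E]
  (g : PseudoRiemannianMetric I n E (TangentSpace I : M → Type _)) (x : M)

/-- **`tr_g T = ∑ₒ T(fₒ, fₒ)`** for a `g_x`-orthonormal family `f : ι → T_xM` with
`card ι = dim`: `tr_g T = tr (♯ ∘ T) = ∑ₒ g(♯(T(fₒ, ·)), fₒ) = ∑ₒ T(fₒ, fₒ)`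
(`trace_eq_sum_bilin_of_orthonormal`, `val_sharp_apply`). [cite: ONeill1983, Ch. 3, pp. 60–61] -/
theorem trace_eq_sum_of_orthonormal_frame {ι : Type*} [Fintype ι] [DecidableEq ι]
    {f : ι → TangentSpace I x} (hf : ∀ a c, g.val x (f a) (f c) = if a = c then 1 else 0)
    (hcard : Fintype.card ι = Module.finrank ℝ E) (T : LinearMap.BilinForm ℝ (TangentSpace I x)) :
    g.trace x T = ∑ a, T (f a) (f a) := by
  have h := trace_eq_sum_bilin_of_orthonormal (V := E) (g.val x) hf hcard
    ((g.sharp x).toLinearMap ∘ₗ T)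
  refine h.trans (Finset.sum_congr rfl fun a _ ↦ ?_)
  rw [LinearMap.comp_apply]
  exact g.val_sharp_apply x (T (f a)) (f a)

end Trace

/-! ### §3 Smooth families of curves through a frame and their energy -/

section LiftSum

variable {E : Type*} [NormedAddCommGroup E] [NormedSpace ℝ E] {H : Type*} [TopologicalSpace H]
  {I : ModelWithCorners ℝ E H} {M : Type*} [TopologicalSpace M] [ChartedSpace H M]
  [IsManifold I ∞ M]
  {EN : Type*} [NormedAddCommGroup EN] [NormedSpace ℝ EN] {HN : Type*} [TopologicalSpace HN]
  {J : ModelWithCorners ℝ EN HN} {N : Type*} [TopologicalSpace N] [ChartedSpace HN N]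

/-- **Finite sums of `C^∞` lifts along a map are `C^∞` lifts** (induction on the sum with
`contMDiff_liftAlong_add`, starting from the zero section along the base map). [folklore] -/
theorem contMDiff_liftAlong_finset_sum {ι : Type*} (s : Finset ι) {c : N → M}
    (hc : ContMDiff J I ∞ c) {Z : ι → Π a : N, TangentSpace I (c a)}
    (hZ : ∀ i ∈ s, ContMDiff J I.tangent ∞
      (fun a ↦ (TotalSpace.mk' E (c a) (Z i a) : TangentBundle I M))) :
    ContMDiff J I.tangent ∞
      (fun a ↦ (TotalSpace.mk' E (c a) (∑ i ∈ s, Z i a) : TangentBundle I M)) := by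
  classical
  induction s using Finset.induction_on with
  | empty =>
    simp only [Finset.sum_empty]
    exact (contMDiff_zeroSection ℝ (TangentSpace I : M → Type _)).comp hc
  | insert i s hi ih =>
    have h := contMDiff_liftAlong_add (hZ i (Finset.mem_insert_self i s))
      (ih fun j hj ↦ hZ j (Finset.mem_insert_of_mem hj))
    refine h.congr fun a ↦ ?_
    rw [Finset.sum_insert hi]

end LiftSum

section Family

variable {E : Type*} [NormedAddCommGroup E] [NormedSpace ℝ E] [FiniteDimensional ℝ E]
  [CompleteSpace E] {H : Type*} [TopologicalSpace H] {I : ModelWithCorners ℝ E H}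
  {M : Type*} [TopologicalSpace M] [ChartedSpace H M] [IsManifold I ∞ M] [T2Space M]
  [BoundarylessManifold I M]
  {cov : CovariantDerivative I E (TangentSpace I : M → Type _)}
  [CovariantDerivative.ContMDiffCovariantDerivative cov 1]
  [CovariantDerivative.ContMDiffCovariantDerivative cov ∞]

/-- **The family of curves `(t, w) ↦ exp_{γ(t)}(∑ᵢ ℓᵢ(w) Xᵢ(t))` is `C^∞` on `ℝ × E`** for a
`C^∞` curve `γ`, `C^∞` fields `Xᵢ` along it, continuous linear coefficient functionals `ℓᵢ` and a
geodesically complete `C^∞` connection (the lift `(t, w) ↦ (γ t, ∑ᵢ ℓᵢ(w) Xᵢ(t))` is `C^∞`,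
`contMDiff_liftAlong_finset_sum`/`contMDiff_liftAlong_smul`, and `exp` is `C^∞` on `TM`,
`contMDiffOn_expMap_totalSpace`). Lee 2018, Prop. 5.19 and Lemma 6.2.
[cite: LeeRiemannianManifolds2018, Prop. 5.19] -/
theorem contMDiff_expMap_frame_family (hc : IsGeodesicallyComplete cov) {ι : Type*} [Fintype ι]
    {γ : ℝ → M} (hγ : ContMDiff 𝓘(ℝ, ℝ) I ∞ γ) {X : ι → Π t : ℝ, TangentSpace I (γ t)}
    (hX : ∀ i, ContMDiff 𝓘(ℝ, ℝ) I.tangent ∞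
      (fun t ↦ (TotalSpace.mk' E (γ t) (X i t) : TangentBundle I M)))
    (ℓ : ι → E →L[ℝ] ℝ) :
    ContMDiff 𝓘(ℝ, ℝ × E) I ∞
      (fun q : ℝ × E ↦ expMap cov (γ q.1) (∑ i, (ℓ i q.2) • X i q.1)) := by
  have hF : ContMDiff (𝓘(ℝ, ℝ).prod 𝓘(ℝ, E)) I.tangent ∞
      (fun q : ℝ × E ↦ (TotalSpace.mk' E (γ q.1) (∑ i, (ℓ i q.2) • X i q.1) : TangentBundle I M)) := by
    refine contMDiff_liftAlong_finset_sum (Finset.univ : Finset ι) (hγ.comp contMDiff_fst) ?_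
    intro i _
    exact contMDiff_liftAlong_smul (c := fun q : ℝ × E ↦ γ q.1) (Z := fun q : ℝ × E ↦ X i q.1)
      ((hX i).comp contMDiff_fst)
      (((ℓ i).contDiff.contMDiff (n := ∞)).comp contMDiff_snd)
  have hexp := contMDiffOn_expMap_totalSpace (cov := cov) (k := (⊤ : ℕ∞)) le_top
  have hmem : ∀ q : ℝ × E,
      (TotalSpace.mk' E (γ q.1) (∑ i, (ℓ i q.2) • X i q.1) : TangentBundle I M) ∈
        {p : TangentBundle I M | (1 : ℝ) ∈ maximalGeodesicDomain cov p.proj p.2} := fun q ↦ by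
    show (1 : ℝ) ∈ maximalGeodesicDomain cov (γ q.1) (∑ i, (ℓ i q.2) • X i q.1)
    rw [(maximalGeodesic_of_isGeodesicallyComplete hc _ _).1]
    exact mem_univ _
  have h := hexp.comp_contMDiff hF hmem
  rw [modelWithCornersSelf_prod, ← chartedSpaceSelf_prod]
  exact h

end Family

section Energy

variable {E : Type*} [NormedAddCommGroup E] [NormedSpace ℝ E] [FiniteDimensional ℝ E]
  {H : Type*} [TopologicalSpace H] {I : ModelWithCorners ℝ E H}
  {M : Type*} [TopologicalSpace M] [ChartedSpace H M] [IsManifold I ∞ M]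
  (g : PseudoRiemannianMetric I ∞ E (TangentSpace I : M → Type _))

/-- **The energy of a `C^∞` family of curves is `C^∞` in the parameter**: for
`P : ℝ × E → M` of class `C^∞` (parameter `w ∈ E`, a finite-dimensional normed space),
`w ↦ ∫_a^b g(∂ₜP(t, w), ∂ₜP(t, w)) dt` is `C^∞` (the integrand is `C^∞` jointly:
`contMDiffAt_lift_velocity_family`, `contMDiffAt_val_apply_along`; then iterated differentiation
under the integral sign, `contDiff_parametric_intervalIntegral`). Lee 2018, Ch. 6, p. 152
(smooth dependence of the energy of a variation). [folklore] -/
theorem contDiff_energy_family {P : ℝ × E → M} (hP : ContMDiff 𝓘(ℝ, ℝ × E) I ∞ P) (a b : ℝ) :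
    ContDiff ℝ ∞ fun w : E ↦ ∫ t in a..b,
      g.val (P (t, w)) (velocity I (fun t' ↦ P (t', w)) t) (velocity I (fun t' ↦ P (t', w)) t) := by
  have hV : ∀ q : ℝ × E, ContMDiffAt 𝓘(ℝ, ℝ × E) I.tangent ∞ (fun q : ℝ × E ↦
      (TotalSpace.mk' E (P q) (velocity I (fun t' ↦ P (t', q.2)) q.1) : TangentBundle I M)) q :=
    fun q ↦ HarmonicMap.contMDiffAt_lift_velocity_family isOpen_univ hP.contMDiffOn (mem_univ q)
  have hH : ContMDiff 𝓘(ℝ, ℝ × E) 𝓘(ℝ, ℝ) ∞ (fun q : ℝ × E ↦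
      g.val (P q) (velocity I (fun t' ↦ P (t', q.2)) q.1) (velocity I (fun t' ↦ P (t', q.2)) q.1)) :=
    fun q ↦ contMDiffAt_val_apply_along g le_rfl (hV q) (hV q)
  exact Literature.Analysis.FunctionSpaces.contDiff_parametric_intervalIntegral hH.contDiff a b

end Energy

/-! ### §4 The Hessian of a function squeezed under quadratics along a geodesic -/

section HessianSqueeze

variable {E : Type*} [NormedAddCommGroup E] [NormedSpace ℝ E] [FiniteDimensional ℝ E]
  [CompleteSpace E] {H : Type*} [TopologicalSpace H] {I : ModelWithCorners ℝ E H}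
  {M : Type*} [TopologicalSpace M] [ChartedSpace H M] [IsManifold I ∞ M] [T2Space M]
  [BoundarylessManifold I M]
  (g : PseudoRiemannianMetric I ∞ E (TangentSpace I : M → Type _)) [g.HasLeviCivita]
  [CovariantDerivative.ContMDiffCovariantDerivative g.leviCivita 1]

/-- **Hessian bound from quadratic upper barriers along a geodesic** ("second variation in
barrier form"): if `β` is `C^∞` near `y` and for every `ε > 0`,
`β(exp_y(σ v)) ≤ β(y) + aσ + (B + ε)σ²` for `σ` near `0`, then `Hess β(y)(v, v) ≤ 2B` — the second
derivative of `σ ↦ β(exp_y(σv))` at `0` is `Hess β(y)(v, v)` (`hasDerivAt_mvfderiv_velocity_of_isGeodesicOn`,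
the curve being the geodesic `γ_v`) and is squeezed by `deriv2_le_of_le_quadratic`.
[cite: LeeRiemannianManifolds2018, Thm. 10.22 (second variation, barrier reading)] -/
theorem hessian_le_of_le_quadratic_along_expMap (hc : IsGeodesicallyComplete g.leviCivita)
    (y : M) (v : TangentSpace I y) {β : M → ℝ} (hβ : ∀ᶠ y' in 𝓝 y, CMDiffAt ∞ β y')
    {a B : ℝ} (hbound : ∀ ε > (0 : ℝ), ∀ᶠ σ in 𝓝 (0 : ℝ),
      β (expMap g.leviCivita y (σ • v)) ≤ β y + a * σ + (B + ε) * σ ^ 2) :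
    g.hessian β y v v ≤ 2 * B := by
  have h2 : (2 : ℕ∞ω) ≤ ∞ := WithTop.coe_le_coe.2 le_top
  set c : ℝ → M := fun σ ↦ expMap g.leviCivita y (σ • v) with hc_def
  have hgeo : IsGeodesic g.leviCivita c := isGeodesic_expMap_smul_of_isGeodesicallyComplete hc y v
  have hcd : ∀ σ, MDifferentiableAt 𝓘(ℝ, ℝ) I c σ := fun σ ↦
    mdifferentiableAt_of_mdifferentiableAt_lift (hgeo.1 σ (mem_univ σ))
  have hc0 : c 0 = y := by
    show expMap g.leviCivita y ((0 : ℝ) • v) = y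
    rw [zero_smul]
    exact expMap_zero (cov := g.leviCivita) y
  have hv0 : velocity I c 0 = v := velocity_expMap_smul_zero y v
  -- `β` is `C^∞` at the points of `c` near `σ = 0`
  have hβc : ∀ᶠ σ in 𝓝 (0 : ℝ), CMDiffAt ∞ β (c σ) := by
    have hcont : ContinuousAt c 0 := (hcd 0).continuousAt
    rw [← hc0] at hβ
    exact hcont.eventually hβ
  -- first and second derivative of `k = β ∘ c`
  set k : ℝ → ℝ := fun σ ↦ β (c σ) with hk_def
  set k' : ℝ → ℝ := fun σ ↦ mvfderiv I β (c σ) (velocity I c σ) with hk'_def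
  have hk : ∀ᶠ σ in 𝓝 (0 : ℝ), HasDerivAt k (k' σ) σ := by
    filter_upwards [hβc] with σ hσ
    exact hasDerivAt_comp_curve_mvfderiv (hσ.mdifferentiableAt (by simp)) (hcd σ)
  have hk' : HasDerivAt k' (g.hessian β y v v) 0 := by
    have h := g.hasDerivAt_mvfderiv_velocity_of_isGeodesicOn hgeo (mem_univ 0)
      ((hβc.self_of_nhds).of_le h2)
    rw [hc0] at h
    rw [hv0] at h
    exact h
  refine deriv2_le_of_le_quadratic (a := a) hk hk' fun ε hε ↦ ?_
  filter_upwards [hbound ε hε] with σ hσ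
  show β (c σ) ≤ β (c 0) + a * σ + (B + ε) * σ ^ 2
  rw [hc0]
  exact hσ

end HessianSqueeze

/-! ### §5 The endpoint barrier (Bamler 2020a, §3.2, proof of Thm. 3.5) -/

section Endpoint

variable {E : Type*} [NormedAddCommGroup E] [NormedSpace ℝ E] [FiniteDimensional ℝ E]
  [CompleteSpace E] {H : Type*} [TopologicalSpace H] {I : ModelWithCorners ℝ E H} [I.Boundaryless]
  {M : Type*} [TopologicalSpace M] [ChartedSpace H M] [IsManifold I ∞ M] [T2Space M]
  (g : PseudoRiemannianMetric I ∞ E (TangentSpace I : M → Type _)) [g.HasLeviCivita]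
  [CovariantDerivative.ContMDiffCovariantDerivative g.leviCivita 1]
  [CovariantDerivative.ContMDiffCovariantDerivative g.leviCivita ∞]

set_option maxHeartbeats 1600000 in
/-- **The endpoint barrier for `d(p, ·)²` with Bamler's Laplacian bound** (Bamler 2020a, §3.2,
proof of Thm. 3.5, spatial part, in barrier form). Let `g` be a smooth complete Riemannian metric
on a Hausdorff manifold (any boundaryless model with corners on `E`), `γ(t) = exp_p(tu)` a unit speed geodesic, `d > 0`,
`y = γ(d)`. Then `t ↦ Ric(γ̇(t), γ̇(t))` is continuous on `[0, d]` and there is `β : M → ℝ` with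
`d(p, y')² ≤ β(y')` for `y'` near `y`, `β(y) = d²`, `β` of class `C^∞` near `y`, and
`Δ_g β(y) ≤ 2 + 2d ∫₀ᵈ ((dim M − 1)(π/2d)² cos²(πt/2d) − sin²(πt/2d) Ric(γ̇(t), γ̇(t))) dt`
("`Δ_y d_t²(x, y) ≤ 2 + ∫₀ᵈ (2(n−1)d(π/2d)² cos²(πs/2d) − 2d sin²(πs/2d) Ric(γ′, γ′)) ds`"):
`β = F ∘ L` with `L` normal coordinates at `y` (`exists_geodesicBall_edist`) and
`F(w) = d ∫₀ᵈ |∂ₜ exp_{γ(t)}(∑ₒ g_y(w, fₒ) aₒ(t) eₒ(t))|² dt`, `(eₒ)` the parallel transport of an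
orthonormal frame `(fₒ)` at `y` headed by `γ̇(d)`, `a_none(t) = t/d`, `aᵢ(t) = sin(πt/2d)` (cut off
away from `[0, d]`): `d(p, exp_y w)² ≤ L(c_w)² ≤ F(w)` (`edist_sq_le_mul_energy`), and along
`σ ↦ exp_y(σ fₒ)` the function `β` is `d` times the energy of the variation `exp_{γ(t)}(σ aₒeₒ)`,
squeezed by `energy_le_taylor_two_sided` (`hessian_le_of_le_quadratic_along_expMap`); the trace
over the frame is computed with `sum_val_curvature_eq_ricci`.
[cite: Bamler2020Entropy, §3.2, proof of Thm. 3.5] -/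
theorem exists_distSq_barrier_at_endpoint (hg : g.IsRiemannian)
    (hc : IsGeodesicallyComplete g.leviCivita) (p : M) (u : TangentSpace I p)
    (hu : g.val p u u = 1) {d : ℝ} (hd : 0 < d) :
    ContinuousOn (fun t ↦ g.leviCivita.ricci (expMap g.leviCivita p (t • u))
        (velocity I (fun t ↦ expMap g.leviCivita p (t • u)) t)
        (velocity I (fun t ↦ expMap g.leviCivita p (t • u)) t)) (Icc 0 d) ∧
    ∃ β : M → ℝ,
      (∀ᶠ y in 𝓝 (expMap g.leviCivita p (d • u)), (g.edist hg p y).toReal ^ 2 ≤ β y) ∧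
      β (expMap g.leviCivita p (d • u)) = d ^ 2 ∧
      (∀ᶠ y in 𝓝 (expMap g.leviCivita p (d • u)), CMDiffAt ∞ β y) ∧
      g.laplaceBeltrami β (expMap g.leviCivita p (d • u)) ≤
        2 + 2 * d * ∫ t in (0 : ℝ)..d,
          (((Module.finrank ℝ E : ℝ) - 1) * (Real.pi / (2 * d)) ^ 2 *
              Real.cos (Real.pi / (2 * d) * t) ^ 2 -
            Real.sin (Real.pi / (2 * d) * t) ^ 2 *
              g.leviCivita.ricci (expMap g.leviCivita p (t • u))
                (velocity I (fun t ↦ expMap g.leviCivita p (t • u)) t)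
                (velocity I (fun t ↦ expMap g.leviCivita p (t • u)) t)) := by
  classical
  have hLC := PseudoRiemannianMetric.isLeviCivita_leviCivita_holds (g := g)
  have hreg : g.leviCivita.IsLocallyContMDiff ∞ := hLC.isLocallyContMDiff ⊤ (le_of_eq rfl)
  have hreg1 : g.leviCivita.IsLocallyContMDiff 1 :=
    hLC.isLocallyContMDiff 1 (by exact_mod_cast le_top)
  have h2 : (2 : ℕ∞ω) ≤ (∞ : ℕ∞ω) := WithTop.coe_le_coe.2 le_top
  haveI : Fact ((1 : ℕ∞ω) ≤ (∞ : ℕ∞ω)) := ⟨by exact_mod_cast le_top⟩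
  -- the geodesic
  set γ : ℝ → M := fun t ↦ expMap g.leviCivita p (t • u) with hγ_def
  have hgeo : IsGeodesic g.leviCivita γ := isGeodesic_expMap_smul_of_isGeodesicallyComplete hc p u
  have hγfun : γ = maximalGeodesic g.leviCivita p u := funext fun t ↦ expMap_smul hc p u t
  have hγs : ContMDiff 𝓘(ℝ, ℝ) I ∞ γ := by
    rw [hγfun]
    exact (contMDiff_maximalGeodesic_family hc p).comp
      (contMDiff_id.prodMk (contMDiff_const (c := (show E from u))))
  have hγd : ∀ t, MDifferentiableAt 𝓘(ℝ, ℝ) I γ t := fun t ↦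
    mdifferentiableAt_of_mdifferentiableAt_lift (hgeo.1 t (mem_univ t))
  have hγc : ∀ t, ContinuousAt (tangentLift I γ) t := fun t ↦
    (hgeo.1 t (mem_univ t)).continuousAt
  have hγlift : ContMDiff 𝓘(ℝ, ℝ) I.tangent ∞
      (fun t ↦ (TotalSpace.mk' E (γ t) (velocity I γ t) : TangentBundle I M)) :=
    contMDiff_lift_velocity_of_contMDiff hγs
  have hγ0 : γ 0 = p := by
    show expMap g.leviCivita p ((0 : ℝ) • u) = p
    rw [zero_smul]
    exact expMap_zero (cov := g.leviCivita) p
  have hspeed : ∀ t, g.val (γ t) (velocity I γ t) (velocity I γ t) = 1 := by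
    intro t
    have h := g.val_velocity_eq_of_isGeodesicOn_holds isOpen_univ ordConnected_univ hgeo
      (mem_univ t) (mem_univ 0)
    have hv0 : (velocity I γ 0 : E) = (u : E) := velocity_expMap_smul_zero p u
    rw [h, hv0, hγ0, hu]
  -- the orthonormal frame at `γ d` headed by `γ̇ d`, transported along `γ`
  obtain ⟨k, f₀, hf₀none, hf₀on, hcard⟩ := exists_orthonormal_frame_with_head g hg (γ d) (hspeed d)
  have hd₀ : d ∈ Ioo (-1 : ℝ) (d + 1) := ⟨by linarith, by linarith⟩
  obtain ⟨e, he0, hepar, helift, heon⟩ :=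
    exists_parallel_orthonormal_frame_smooth g hg hLC.2 hreg hγs hd₀ f₀ hf₀on
  -- `e none = γ̇` on the interval (both are parallel and agree at `d`)
  have hvelpar : IsParallelAlongOn g.leviCivita γ (fun t ↦ velocity I γ t)
      (Ioo (-1 : ℝ) (d + 1)) := fun t _ ↦ ⟨hgeo.1 t (mem_univ t), hgeo.2 t (mem_univ t)⟩
  have henone : ∀ t ∈ Ioo (-1 : ℝ) (d + 1), e none t = velocity I γ t := fun t ht ↦
    eq_of_isParallelAlongOn g hg hLC.2 ordConnected_Ioo (hepar none) hvelpar hd₀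
      (by rw [he0, hf₀none]) ht
  -- the cutoff and the profiles
  obtain ⟨χ, hχs, hχ1, hχneg, hχpos⟩ := exists_smooth_cutoff_Icc d
  set cπ : ℝ := Real.pi / (2 * d) with hcπ
  set φ : Option (Fin k) → ℝ → ℝ := fun o t ↦ if o = none then t / d else Real.sin (cπ * t)
    with hφ_def
  have hφs : ∀ o, ContDiff ℝ ∞ (φ o) := by
    intro o
    by_cases ho : o = none
    · simp only [hφ_def, ho, if_true]
      exact contDiff_id.div_const d
    · simp only [hφ_def, ho, if_false]
      exact Real.contDiff_sin.comp (contDiff_const.mul contDiff_id)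
  set a : Option (Fin k) → ℝ → ℝ := fun o t ↦ χ t * φ o t with ha_def
  have has : ∀ o, ContDiff ℝ ∞ (a o) := fun o ↦ hχs.mul (hφs o)
  have haneg : ∀ o t, t ≤ -1 / 2 → a o t = 0 := fun o t ht ↦ by
    show χ t * φ o t = 0
    rw [hχneg t ht, zero_mul]
  have hapos : ∀ o t, d + 1 / 2 ≤ t → a o t = 0 := fun o t ht ↦ by
    show χ t * φ o t = 0
    rw [hχpos t ht, zero_mul]
  have ha0 : ∀ o, a o 0 = 0 := fun o ↦ by
    show χ 0 * φ o 0 = 0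
    simp [hφ_def]
  have had : ∀ o, a o d = 1 := fun o ↦ by
    show χ d * φ o d = 1
    rw [hχ1 d ⟨by linarith, by linarith⟩, one_mul]
    by_cases ho : o = none
    · simp only [hφ_def, ho, if_true]
      exact div_self hd.ne'
    · simp only [hφ_def, ho, if_false, hcπ]
      rw [show Real.pi / (2 * d) * d = Real.pi / 2 by field_simp]
      exact Real.sin_pi_div_two
  -- the variation fields `X o = a o • e o`
  set X : Option (Fin k) → Π t : ℝ, TangentSpace I (γ t) := fun o t ↦ a o t • e o t
    with hX_def
  have hzeroLift : ContMDiff 𝓘(ℝ, ℝ) I.tangent ∞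
      (fun t ↦ (TotalSpace.mk' E (γ t) (0 : TangentSpace I (γ t)) :
        TangentBundle I M)) :=
    (contMDiff_zeroSection ℝ (TangentSpace I : M → Type _)).comp hγs
  have hXs : ∀ o, ContMDiff 𝓘(ℝ, ℝ) I.tangent ∞
      (fun t ↦ (TotalSpace.mk' E (γ t) (X o t) : TangentBundle I M)) := by
    intro o t
    by_cases ht : t ∈ Ioo (-1 : ℝ) (d + 1)
    · exact contMDiffAt_liftAlong_smul (helift o t ht) ((has o).contDiffAt.contMDiffAt)
    · refine (hzeroLift t).congr_of_eventuallyEq ?_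
      rcases le_or_gt t (-1) with hle | hgt
      · filter_upwards [(isOpen_gt' (-1 / 2 : ℝ)).mem_nhds (show t < -1 / 2 by linarith)]
          with s hs
        show (TotalSpace.mk' E (γ s) (X o s) : TangentBundle I M) =
          TotalSpace.mk' E (γ s) (0 : TangentSpace I (γ s))
        rw [hX_def]
        simp only [haneg o s (le_of_lt hs), zero_smul]
      · have hge : d + 1 ≤ t := by
          by_contra hlt
          exact ht ⟨hgt, lt_of_not_ge hlt⟩
        filter_upwards [(isOpen_lt' (d + 1 / 2)).mem_nhds (show d + 1 / 2 < t by linarith)]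
          with s hs
        show (TotalSpace.mk' E (γ s) (X o s) : TangentBundle I M) =
          TotalSpace.mk' E (γ s) (0 : TangentSpace I (γ s))
        rw [hX_def]
        simp only [hapos o s (le_of_lt hs), zero_smul]
  have hX0 : ∀ o, X o 0 = 0 := fun o ↦ by
    show a o 0 • e o 0 = 0
    rw [ha0, zero_smul]
  have hXd : ∀ o, X o d = f₀ o := fun o ↦ by
    show a o d • e o d = f₀ o
    rw [had, one_smul, he0]
  -- normal coordinates at `γ d`
  obtain ⟨εb, hεb, U, hUo, hyU, L, hLF, hFL, -, hLs, -, -, -⟩ :=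
    exists_geodesicBall_edist g hg (γ d)
  -- the family of curves and its energy
  set ℓ : Option (Fin k) → E →L[ℝ] ℝ := fun o ↦
    (show E →L[ℝ] E →L[ℝ] ℝ from g.val (γ d)).flip (show E from f₀ o) with hℓ_def
  have hℓ : ∀ o (w : E), ℓ o w = g.val (γ d) w (f₀ o) := fun o w ↦ rfl
  set P : ℝ × E → M := fun q ↦ expMap g.leviCivita (γ q.1) (∑ o, (ℓ o q.2) • X o q.1)
    with hP_def
  have hP : ContMDiff 𝓘(ℝ, ℝ × E) I ∞ P := contMDiff_expMap_frame_family hc hγs hXs ℓ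
  set 𝓔 : (ℝ → M) → ℝ := fun c ↦ ∫ t in (0 : ℝ)..d, g.val (c t) (velocity I c t)
    (velocity I c t) with h𝓔_def
  set F : E → ℝ := fun w ↦ d * 𝓔 (fun t' ↦ P (t', w)) with hF_def
  have hF : ContDiff ℝ ∞ F := contDiff_const.mul (contDiff_energy_family g hP 0 d)
  set β : M → ℝ := fun y' ↦ F (L y') with hβ_def
  -- `𝓔 γ = d`, `L (γ d) = 0` and `F 0 = d²`
  have h𝓔γ : 𝓔 γ = d := by
    show ∫ t in (0 : ℝ)..d, g.val (γ t) (velocity I γ t) (velocity I γ t) = d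
    simp_rw [hspeed]
    rw [intervalIntegral.integral_const, smul_eq_mul, mul_one, sub_zero]
  have hexp0 : riemannianExpMap g (γ d) 0 = γ d := riemannianExpMap_zero g (γ d)
  have hL0 : L (γ d) = 0 := by
    have h00 : g.val (γ d) (show TangentSpace I (γ d) from (0 : E))
        (show TangentSpace I (γ d) from (0 : E)) < εb ^ 2 := by
      change g.val (γ d) (0 : TangentSpace I (γ d)) (0 : TangentSpace I (γ d)) <
        εb ^ 2
      simp only [map_zero]
      positivity
    have h := (hLF 0 h00).2.2
    exact (congrArg L hexp0).symm.trans h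
  have hP0 : (fun t' ↦ P (t', (0 : E))) = γ := by
    funext t'
    show expMap g.leviCivita (γ t') (∑ o, (ℓ o 0) • X o t') = γ t'
    simp only [map_zero, zero_smul, Finset.sum_const_zero]
    exact expMap_zero (cov := g.leviCivita) (γ t')
  have hF0 : F 0 = d ^ 2 := by
    show d * 𝓔 (fun t' ↦ P (t', (0 : E))) = d ^ 2
    rw [hP0, h𝓔γ, sq]
  have htouch : β (γ d) = d ^ 2 := by
    show F (L (γ d)) = d ^ 2
    rw [hL0, hF0]
  have hsmooth : ∀ᶠ y' in 𝓝 (γ d), CMDiffAt ∞ β y' := by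
    filter_upwards [hUo.mem_nhds hyU] with y' hy'
    exact (hF.contMDiff (L y')).comp y' (hLs.contMDiffAt (hUo.mem_nhds hy'))
  -- continuity of `Ric(γ̇, γ̇)` on the interval, from `Ric = ∑ₒ g(R(eₒ, γ̇)γ̇, eₒ)`
  have hIcc : Icc (0 : ℝ) d ⊆ Ioo (-1 : ℝ) (d + 1) := fun t ht ↦
    ⟨by linarith [ht.1], by linarith [ht.2]⟩
  set ρ : Option (Fin k) → ℝ → ℝ := fun o t ↦ g.val (γ t) (g.leviCivita.curvature (γ t) (e o t)
    (velocity I γ t) (velocity I γ t)) (e o t) with hρ_def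
  have hρc : ∀ o, ∀ t ∈ Ioo (-1 : ℝ) (d + 1), ContinuousAt (ρ o) t := fun o t ht ↦
    continuousAt_val_curvature_along g g.leviCivita hreg1 hreg (helift o t ht).continuousAt
      (hγc t) (hγc t) (helift o t ht).continuousAt
  have hρsum : ∀ t ∈ Ioo (-1 : ℝ) (d + 1), ∑ o, ρ o t =
      g.leviCivita.ricci (γ t) (velocity I γ t) (velocity I γ t) := fun t ht ↦
    sum_val_curvature_eq_ricci g g.leviCivita (γ t) (heon t ht) hcard (velocity I γ t)
  have hRicAt : ∀ t ∈ Ioo (-1 : ℝ) (d + 1), ContinuousAt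
      (fun t ↦ g.leviCivita.ricci (γ t) (velocity I γ t) (velocity I γ t)) t := by
    intro t ht
    have hc' : ContinuousAt (fun s ↦ ∑ o, ρ o s) t :=
      tendsto_finsetSum (Finset.univ : Finset (Option (Fin k))) fun o _ ↦ hρc o t ht
    exact hc'.congr (eventually_of_mem (isOpen_Ioo.mem_nhds ht) fun s hs ↦ hρsum s hs)
  have hRicc : ContinuousOn
      (fun t ↦ g.leviCivita.ricci (γ t) (velocity I γ t) (velocity I γ t))
      (Icc 0 d) := fun t ht ↦ (hRicAt t (hIcc ht)).continuousWithinAt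
  refine ⟨hRicc, β, ?_, htouch, hsmooth, ?_⟩
  · -- domination: `d(p, y')² ≤ L(c_w)² ≤ F (L y')` for `y' ∈ U`, `w = L y'`
    filter_upwards [hUo.mem_nhds hyU] with y' hy'
    obtain ⟨-, hexpw⟩ := hFL y' hy'
    set w : E := L y' with hw_def
    set Xw : Π t : ℝ, TangentSpace I (γ t) := fun t ↦ ∑ o, (ℓ o w) • X o t with hXw_def
    have hXws : ContMDiff 𝓘(ℝ, ℝ) I.tangent ∞
        (fun t ↦ (TotalSpace.mk' E (γ t) (Xw t) : TangentBundle I M)) :=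
      contMDiff_liftAlong_finset_sum Finset.univ hγs fun o _ ↦
        contMDiff_liftAlong_smul (hXs o) contMDiff_const
    have hXw0 : Xw 0 = 0 := by
      show ∑ o, (ℓ o w) • X o 0 = 0
      simp only [hX0, smul_zero, Finset.sum_const_zero]
    have hXwd : Xw d = w := by
      show ∑ o, (ℓ o w) • X o d = w
      simp only [hXd, hℓ]
      exact (eq_sum_bilin_smul_of_orthonormal (V := E) (g.val (γ d)) hf₀on hcard w).symm
    have h := (HaslhoferMuller.edist_sq_le_mul_energy g le_rfl hg hc p u hXws hXw0 hd.le 1).2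
    have hend : expMap g.leviCivita (expMap g.leviCivita p (d • u)) ((1 : ℝ) • Xw d) = y' := by
      rw [one_smul, hXwd]
      exact hexpw
    rw [hend] at h
    have key := congrArg (fun (Y : Π t : ℝ, TangentSpace I (γ t)) ↦
      d * 𝓔 (fun t' ↦ expMap g.leviCivita (γ t') (Y t'))) (funext fun t ↦ one_smul ℝ (Xw t))
    exact h.trans_eq key
  · /- the Laplacian bound: `Δβ(γ d) = ∑ₒ Hess β(fₒ, fₒ) ≤ ∑ₒ 2d Qₒ = 2d ∫₀ᵈ ∑ₒ qₒ`, and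
      `∑ₒ qₒ = 1/d² + k(π/2d)² cos² − sin² Ric(γ̇, γ̇)` on `[0, d]` -/
    -- the index integrands `q o` of the fields `X o` and their integrals
    set qf : Option (Fin k) → ℝ → ℝ := fun o t ↦
      g.val (γ t) (g.leviCivita.curvature (γ t) (X o t) (velocity I γ t) (X o t))
          (velocity I γ t) +
        g.val (γ t) (covariantDerivAlong g.leviCivita γ (X o) t)
          (covariantDerivAlong g.leviCivita γ (X o) t) with hqf_def
    have hqfc : ∀ o, Continuous (qf o) := fun o ↦
      (integral_energy_le_taylor g le_rfl hc (hXs o) hd.le).1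
    set Q : Option (Fin k) → ℝ := fun o ↦ ∫ t in (0 : ℝ)..d, qf o t with hQ_def
    set I₁ : Option (Fin k) → ℝ := fun o ↦ ∫ t in (0 : ℝ)..d,
      2 * g.val (γ t) (covariantDerivAlong g.leviCivita γ (X o) t) (velocity I γ t)
      with hI₁_def
    -- (A) the Hessian of `β` at `γ d` in the frame directions
    have hHess : ∀ o, g.hessian β (γ d) (f₀ o) (f₀ o) ≤ 2 * (d * Q o) := by
      intro o
      refine hessian_le_of_le_quadratic_along_expMap g hc (γ d) (f₀ o) hsmooth
        (a := d * I₁ o) fun ε hε ↦ ?_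
      obtain ⟨δ, hδ, hδ'⟩ := HaslhoferMuller.energy_le_taylor_two_sided g le_rfl hc (hXs o) hd.le
        (ε / d ^ 2) (by positivity)
      filter_upwards [Icc_mem_nhds (show -δ < 0 by linarith) hδ,
        Ioo_mem_nhds (show -εb < 0 by linarith) hεb] with σ hσ hσb
      -- `σ fₒ` lies in the normal ball, so `β(exp(σ fₒ)) = F(σ fₒ)`
      have hsmall : g.val (γ d) (show TangentSpace I (γ d) from σ • (f₀ o : E))
          (show TangentSpace I (γ d) from σ • (f₀ o : E)) < εb ^ 2 := by
        change g.val (γ d) (σ • f₀ o) (σ • f₀ o) < εb ^ 2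
        simp only [map_smul, FunLike.coe_smul, Pi.smul_apply, smul_eq_mul, hf₀on, if_true,
          mul_one]
        nlinarith [sq_lt_sq' hσb.1 hσb.2]
      have hLσ : L (expMap g.leviCivita (γ d) (σ • f₀ o)) = σ • (f₀ o : E) :=
        (hLF (σ • (f₀ o : E)) hsmall).2.2
      -- along `σ fₒ` the family is the variation `exp_{γ t}(σ Xₒ t)`
      have hfam : (fun t' ↦ P (t', σ • (f₀ o : E))) =
          fun t' ↦ expMap g.leviCivita (γ t') (σ • X o t') := by
        funext t'
        show expMap g.leviCivita (γ t') (∑ o', (ℓ o' (σ • (f₀ o : E))) • X o' t') =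
          expMap g.leviCivita (γ t') (σ • X o t')
        congr 1
        have hcoef : ∀ o', ℓ o' (σ • (f₀ o : E)) = σ * (if o = o' then 1 else 0) := fun o' ↦ by
          rw [hℓ, map_smul, FunLike.coe_smul, Pi.smul_apply, smul_eq_mul, hf₀on]
        simp_rw [hcoef, mul_ite, mul_one, mul_zero, ite_smul, zero_smul, Finset.sum_ite_eq,
          Finset.mem_univ, if_true]
      have hβσ : β (expMap g.leviCivita (γ d) (σ • f₀ o)) =
          d * 𝓔 (fun t' ↦ expMap g.leviCivita (γ t') (σ • X o t')) := by
        show F (L (expMap g.leviCivita (γ d) (σ • f₀ o))) = _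
        rw [hLσ]
        show d * 𝓔 (fun t' ↦ P (t', σ • (f₀ o : E))) = _
        rw [hfam]
      -- the Taylor bound for the energy of this variation
      have hT := hδ' σ hσ
      have hE0 : (∫ t in (0 : ℝ)..d, g.val (γ t) (velocity I γ t) (velocity I γ t)) =
          d := h𝓔γ
      rw [hE0] at hT
      have hT' : 𝓔 (fun t' ↦ expMap g.leviCivita (γ t') (σ • X o t')) ≤
          d + σ * I₁ o + σ * σ * (Q o + ε / d ^ 2 * (d - 0)) := hT
      rw [hβσ, htouch]
      have hd2 : d * (d + σ * I₁ o + σ * σ * (Q o + ε / d ^ 2 * (d - 0))) =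
          d ^ 2 + d * I₁ o * σ + (d * Q o + ε) * σ ^ 2 := by
        field_simp
        ring
      calc d * 𝓔 (fun t' ↦ expMap g.leviCivita (γ t') (σ • X o t'))
          ≤ d * (d + σ * I₁ o + σ * σ * (Q o + ε / d ^ 2 * (d - 0))) :=
            mul_le_mul_of_nonneg_left hT' hd.le
        _ = d ^ 2 + d * I₁ o * σ + (d * Q o + ε) * σ ^ 2 := hd2
    -- (B) the index integrands in the frame, on a neighbourhood of `[0, d]`
    set J : Set ℝ := Ioo (-1 / 4 : ℝ) (d + 1 / 4) with hJ_def
    have hJsub : J ⊆ Ioo (-1 : ℝ) (d + 1) := fun t ht ↦ ⟨by linarith [ht.1], by linarith [ht.2]⟩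
    have hIccJ : Icc (0 : ℝ) d ⊆ J := fun t ht ↦ ⟨by linarith [ht.1], by linarith [ht.2]⟩
    have haφ : ∀ o, ∀ t ∈ J, a o =ᶠ[𝓝 t] φ o := fun o t ht ↦ by
      filter_upwards [isOpen_Ioo.mem_nhds ht] with s hs
      show χ s * φ o s = φ o s
      rw [hχ1 s hs, one_mul]
    have hφd : ∀ o t, deriv (φ o) t = if o = none then 1 / d else cπ * Real.cos (cπ * t) := by
      intro o t
      by_cases ho : o = none
      · simp only [hφ_def, ho, if_true]
        rw [show (fun t : ℝ ↦ t / d) = fun t ↦ t * (1 / d) from funext fun t ↦ by ring]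
        rw [deriv_mul_const_field, deriv_id'', one_mul]
      · simp only [hφ_def, ho, if_false]
        have h : HasDerivAt (fun t ↦ Real.sin (cπ * t)) (Real.cos (cπ * t) * (cπ * 1)) t :=
          (Real.hasDerivAt_sin (cπ * t)).comp t ((hasDerivAt_id t).const_mul cπ)
        rw [h.deriv]
        ring
    have hqf : ∀ o, ∀ t ∈ J, qf o t = deriv (φ o) t ^ 2 - φ o t ^ 2 * ρ o t := by
      intro o t ht
      have ht' := hJsub ht
      have hD : covariantDerivAlong g.leviCivita γ (X o) t = deriv (a o) t • e o t := by
        have h := covariantDerivAlong_smul_holds g.leviCivita (γ := γ) (W := e o) (f := a o)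
          (t₀ := t) ((has o).differentiable (by simp)).differentiableAt (hepar o t ht').1
        rw [(hepar o t ht').2, smul_zero, add_zero] at h
        exact h
      have hda : deriv (a o) t = deriv (φ o) t := (haφ o t ht).deriv_eq
      have hat : a o t = φ o t := (haφ o t ht).self_of_nhds
      have hcurv : g.val (γ t) (g.leviCivita.curvature (γ t) (X o t) (velocity I γ t)
          (X o t)) (velocity I γ t) = a o t ^ 2 * g.val (γ t)
            (g.leviCivita.curvature (γ t) (e o t) (velocity I γ t) (e o t))
            (velocity I γ t) := by
        show g.val (γ t) (g.leviCivita.curvature (γ t) (a o t • e o t) (velocity I γ t)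
          (a o t • e o t)) (velocity I γ t) = _
        simp only [map_smul, FunLike.coe_smul, Pi.smul_apply, smul_eq_mul]
        ring
      have hskew := hLC.val_curvature_skew h2 (γ t) (e o t) (velocity I γ t)
        (e o t) (velocity I γ t)
      have hDD : g.val (γ t) (covariantDerivAlong g.leviCivita γ (X o) t)
          (covariantDerivAlong g.leviCivita γ (X o) t) = deriv (a o) t ^ 2 := by
        rw [hD]
        simp only [map_smul, FunLike.coe_smul, Pi.smul_apply, smul_eq_mul]
        rw [heon t ht' o o, if_pos rfl]
        ring
      show g.val (γ t) (g.leviCivita.curvature (γ t) (X o t) (velocity I γ t) (X o t))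
          (velocity I γ t) + g.val (γ t) (covariantDerivAlong g.leviCivita γ (X o) t)
          (covariantDerivAlong g.leviCivita γ (X o) t) = _
      rw [hcurv, hDD, hskew, hda, hat]
      ring
    -- `ρ none = g(R(γ̇, γ̇)γ̇, γ̇) = 0`
    have hρnone : ∀ t ∈ J, ρ none t = 0 := by
      intro t ht
      have ht' := hJsub ht
      show g.val (γ t) (g.leviCivita.curvature (γ t) (e none t) (velocity I γ t)
        (velocity I γ t)) (e none t) = 0
      rw [henone t ht']
      have hR : g.leviCivita.curvature (γ t) (velocity I γ t) (velocity I γ t)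
          (velocity I γ t) = 0 := by
        have h := g.leviCivita.curvature_antisymm (x := γ t) (velocity I γ t)
          (velocity I γ t) (velocity I γ t)
        have h2' : (2 : ℝ) • g.leviCivita.curvature (γ t) (velocity I γ t)
            (velocity I γ t) (velocity I γ t) = 0 := by
          rw [two_smul]
          nth_rewrite 2 [h]
          exact add_neg_cancel _
        rcases smul_eq_zero.1 h2' with h0 | h0
        · norm_num at h0
        · exact h0
      rw [hR, map_zero]
      rfl
    -- the pointwise sum over the frame
    set w : ℝ → ℝ := fun t ↦ (k : ℝ) * cπ ^ 2 * Real.cos (cπ * t) ^ 2 -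
      Real.sin (cπ * t) ^ 2 * g.leviCivita.ricci (γ t) (velocity I γ t)
        (velocity I γ t) with hw_def
    have hsumq : ∀ t ∈ J, ∑ o, qf o t = 1 / d ^ 2 + w t := by
      intro t ht
      have ht' := hJsub ht
      rw [Finset.sum_congr rfl fun o _ ↦ hqf o t ht, Fintype.sum_option]
      have e1 : deriv (φ none) t = 1 / d := by rw [hφd]; simp
      have e2 : ∀ i : Fin k, deriv (φ (some i)) t = cπ * Real.cos (cπ * t) := fun i ↦ by
        rw [hφd]; simp
      have e3 : ∀ i : Fin k, φ (some i) t = Real.sin (cπ * t) := fun i ↦ by simp [hφ_def]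
      have hric : ∑ i : Fin k, ρ (some i) t =
          g.leviCivita.ricci (γ t) (velocity I γ t) (velocity I γ t) := by
        rw [← hρsum t ht', Fintype.sum_option, hρnone t ht, zero_add]
      simp only [e1, e2, e3, hρnone t ht, mul_zero, sub_zero]
      rw [Finset.sum_sub_distrib, Finset.sum_const, Finset.card_univ, Fintype.card_fin,
        nsmul_eq_mul, ← Finset.mul_sum, hric]
      simp only [hw_def]
      ring
    -- (C) integrate
    have hwc : ContinuousOn w (uIcc (0 : ℝ) d) := by
      rw [uIcc_of_le hd.le]
      refine ContinuousOn.sub (Continuous.continuousOn (by fun_prop)) ?_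
      exact (Continuous.continuousOn (by fun_prop)).mul hRicc
    have hintq : (∫ t in (0 : ℝ)..d, ∑ o, qf o t) = 1 / d + ∫ t in (0 : ℝ)..d, w t := by
      rw [intervalIntegral.integral_congr (g := fun t ↦ 1 / d ^ 2 + w t)
        (fun t ht ↦ hsumq t (hIccJ (by rwa [uIcc_of_le hd.le] at ht))),
        intervalIntegral.integral_add intervalIntegrable_const hwc.intervalIntegrable,
        intervalIntegral.integral_const, smul_eq_mul, sub_zero]
      congr 1
      field_simp
    have hsumQ : ∑ o, Q o = 1 / d + ∫ t in (0 : ℝ)..d, w t := by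
      rw [← hintq, intervalIntegral.integral_finsetSum]
      exact fun o _ ↦ (hqfc o).intervalIntegrable _ _
    -- (D) assemble
    rw [laplaceBeltrami_eq_dalembertian]
    show g.trace (γ d) (g.hessian β (γ d)) ≤ _
    rw [trace_eq_sum_of_orthonormal_frame g (γ d) hf₀on hcard]
    have hk : ((Module.finrank ℝ E : ℝ) - 1) = (k : ℝ) := by
      rw [← hcard, Fintype.card_option, Fintype.card_fin]
      push_cast
      ring
    calc ∑ o, g.hessian β (γ d) (f₀ o) (f₀ o)
        ≤ ∑ o, 2 * (d * Q o) := Finset.sum_le_sum fun o _ ↦ hHess o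
      _ = 2 * d * ∑ o, Q o := by rw [Finset.mul_sum]; exact Finset.sum_congr rfl fun o _ ↦ by ring
      _ = 2 + 2 * d * ∫ t in (0 : ℝ)..d, w t := by rw [hsumQ]; field_simp
      _ = _ := by rw [hk]

end Endpoint

end Literature.Geometry.Riemannian
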